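import Summits.FinalStateConjecture.FinalStateConjecture.Theorems.EIHFluxBalanceInertialRecessionStubIdentificationLinear
import Summits.FinalStateConjecture.FinalStateConjecture.Theorems.EIHFluxBalanceInertialRecessionStubIdentificationCutoff
import Literature.Geometry.Lorentzian.LandauLifshitzFluxLaw

/-!
# Route EIHFluxBalance — `InertialRecession`, line `sublinear-is-free-clean-window-charges`:
# preparations for the covariance of the Landau–Lifshitz four-momentum of a STATIONARY vacuum
# field under linear changes of chart (stub `stub_identification`, part A1c, preparatory half)

Helper file (`--supports stmt-FinalStateConjecture-10166`) for the crux
`Summit.FinalStateConjecture.FinalStateConjecture.Theses.EIHFluxBalance.InertialRecession`.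

Preparatory lemmas for `quasiLocalMomentum_linChart_static` (file `…StubIdentificationCovariance`):
stationarity of the components passes to LL's `h^{μνα}` and kills `∂₀ h` (`hField_add_smul_basisVector`,
`partialDeriv_zero_hField_eq_zero`); the contraction of the derivative index over the spatial block of
the chart matrix (`sum_spatialBlock_contract`, the `Q₀Q₀`-term dies on the antisymmetric `h`); the
linear/affine change of variables for the Lebesgue integral on `E3` (`integral_comp_affineEquiv_E3`) and
the determinant of a linear map of `E3` through its coordinate matrix.
[cite: LandauLifshitz1975, §96 (96.16)–(96.17)]
-/

set_option linter.dupNamespace false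

noncomputable section

-- instance search on the nested operator spaces `E4 →L[ℝ] E4 →L[ℝ] ℝ` is deep
set_option maxSynthPendingDepth 3

open Set Metric Filter MeasureTheory MeasureTheory.Measure Module
open scoped Topology ContDiff RealInnerProductSpace

namespace Summit.FinalStateConjecture.FinalStateConjecture.Theorems

namespace SublinearIsFree.ChargeModel

open Literature.Geometry.Lorentzian Literature.Geometry.Lorentzian.LandauLifshitz
open Literature.Analysis.FluidPDE LLBalance LLGauss SublinearIsFree.WindowCharges

variable {g g' : E4 → E4 →L[ℝ] E4 →L[ℝ] ℝ}

/-! ### Stationary components -/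

/-- **Stationarity passes to `h^{μνα}`**: if `g(x + s∂₀) = g(x)` then `h(x + s∂₀) = h(x)`
(translation covariance of `h`, `KSCharge.hField_comp_sub`). [cite: LandauLifshitz1975, §96 (96.2)] -/
theorem hField_add_smul_basisVector (hstat : ∀ x (s : ℝ), g (x + s • E4.basisVector 0) = g x)
    (x : E4) (s : ℝ) (μ ν α : Fin 4) :
    hField g (x + s • E4.basisVector 0) μ ν α = hField g x μ ν α := by
  have hfun : (fun z ↦ g (z - (-(s • E4.basisVector 0)))) = g := by
    funext z
    rw [sub_neg_eq_add, hstat]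
  have h := KSCharge.hField_comp_sub g (-(s • E4.basisVector 0)) x μ ν α
  rw [hfun, sub_neg_eq_add] at h
  exact h.symm

/-- On a stationary field, `h` on the slice `{z⁰ = τ}` equals `h` on `{z⁰ = 0}`:
`h(z) = h(0, z~)`. [cite: LandauLifshitz1975, §96 (96.2)] -/
theorem hField_eq_hField_slice_zero (hstat : ∀ x (s : ℝ), g (x + s • E4.basisVector 0) = g x)
    (z : E4) (μ ν α : Fin 4) :
    hField g z μ ν α = hField g (E4.ofTimeSpace 0 (E4.spatial z)) μ ν α := by
  have hz : z = E4.ofTimeSpace 0 (E4.spatial z) + (z 0) • E4.basisVector 0 := by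
    rw [add_comm, ← ofTimeSpace_eq_smul_add_ofTimeSpace_zero]
    exact (E4.ofTimeSpace_time_spatial z).symm
  conv_lhs => rw [hz]
  exact hField_add_smul_basisVector hstat _ _ μ ν α

/-- **Stationarity kills `∂₀ h`**: `∂₀ h^{μνα}(x) = 0` wherever `h^{μνα}` is differentiable.
[cite: LandauLifshitz1975, §96 (96.2)] -/
theorem partialDeriv_zero_hField_eq_zero (hstat : ∀ x (s : ℝ), g (x + s • E4.basisVector 0) = g x)
    {x : E4} {μ ν α : Fin 4} (hd : DifferentiableAt ℝ (fun z ↦ hField g z μ ν α) x) :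
    LandauLifshitz.partialDeriv 0 (fun z ↦ hField g z μ ν α) x = 0 := by
  have hline : HasDerivAt (fun s : ℝ ↦ x + s • E4.basisVector 0) (E4.basisVector 0) 0 := by
    simpa using ((hasDerivAt_id (0 : ℝ)).smul_const (E4.basisVector 0)).const_add x
  have hx0 : x + (0 : ℝ) • E4.basisVector 0 = x := by rw [zero_smul, add_zero]
  have hd' : DifferentiableAt ℝ (fun z ↦ hField g z μ ν α) (x + (0 : ℝ) • E4.basisVector 0) := by
    rwa [hx0]
  have hcomp := hd'.hasFDerivAt.comp_hasDerivAt (0 : ℝ) hline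
  have hconst : HasDerivAt (fun s : ℝ ↦ hField g (x + s • E4.basisVector 0) μ ν α) 0 0 := by
    have h : (fun s : ℝ ↦ hField g (x + s • E4.basisVector 0) μ ν α) = fun _ ↦ hField g x μ ν α :=
      funext fun s ↦ hField_add_smul_basisVector hstat x s μ ν α
    rw [h]
    exact hasDerivAt_const 0 _
  have huniq := hcomp.unique hconst
  rw [hx0] at huniq
  exact huniq

/-! ### Index contraction over the spatial block -/

/-- **Contraction over the spatial block.** For `P Q` mutually inverse `4 × 4` matrices and an
array `T` antisymmetric in its two indices,
`Σ_j Σ_{ν'} Σ_{α'} P_{m+1,j+1} Q_{0ν'} Q_{j+1,α'} T_{ν'α'} = Σ_{ν'} Q_{0ν'} T_{ν',m+1}`: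
`Σ_j P_{m+1,j+1} Q_{j+1,α'} = δ_{m+1,α'} − P_{m+1,0} Q_{0α'}` and the `Q₀Q₀`-term dies on the
antisymmetric `T`. [folklore] -/
theorem sum_spatialBlock_contract {P Q : Matrix (Fin 4) (Fin 4) ℝ} (hPQ : P * Q = 1)
    {T : Fin 4 → Fin 4 → ℝ} (hT : ∀ a b, T a b = -T b a) (m : Fin 3) :
    ∑ j : Fin 3, ∑ ν' : Fin 4, ∑ α' : Fin 4, P m.succ j.succ * Q 0 ν' * Q j.succ α' * T ν' α' =
      ∑ ν' : Fin 4, Q 0 ν' * T ν' m.succ := by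
  -- the `Q₀Q₀`-term vanishes
  have hQQ : ∑ ν' : Fin 4, ∑ α' : Fin 4, Q 0 ν' * Q 0 α' * T ν' α' = 0 := by
    have h : ∑ ν' : Fin 4, ∑ α' : Fin 4, Q 0 ν' * Q 0 α' * T ν' α' =
        -∑ ν' : Fin 4, ∑ α' : Fin 4, Q 0 ν' * Q 0 α' * T ν' α' := by
      conv_lhs => rw [Finset.sum_comm]
      rw [← Finset.sum_neg_distrib]
      refine Finset.sum_congr rfl fun a _ ↦ ?_
      rw [← Finset.sum_neg_distrib]
      refine Finset.sum_congr rfl fun b _ ↦ ?_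
      rw [hT b a]
      ring
    linarith
  -- the full contraction `Σ_b P_{m+1,b} Q_{bα'} = δ`
  have hδ : ∀ α' : Fin 4, ∑ j : Fin 3, P m.succ j.succ * Q j.succ α' =
      (1 : Matrix (Fin 4) (Fin 4) ℝ) m.succ α' - P m.succ 0 * Q 0 α' := by
    intro α'
    rw [← hPQ, Matrix.mul_apply]
    simp only [Fin.sum_univ_three, Fin.sum_univ_four, Fin.isValue, Fin.succ_zero_eq_one,
      Fin.succ_one_eq_two, Fin.reduceSucc]
    ring
  calc ∑ j : Fin 3, ∑ ν' : Fin 4, ∑ α' : Fin 4, P m.succ j.succ * Q 0 ν' * Q j.succ α' * T ν' α'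
      = ∑ ν' : Fin 4, ∑ α' : Fin 4, (∑ j : Fin 3, P m.succ j.succ * Q j.succ α') *
          (Q 0 ν' * T ν' α') := by
        rw [Finset.sum_comm]
        refine Finset.sum_congr rfl fun ν' _ ↦ ?_
        rw [Finset.sum_comm]
        refine Finset.sum_congr rfl fun α' _ ↦ ?_
        rw [Finset.sum_mul]
        refine Finset.sum_congr rfl fun j _ ↦ ?_
        ring
    _ = ∑ ν' : Fin 4, ∑ α' : Fin 4, ((1 : Matrix (Fin 4) (Fin 4) ℝ) m.succ α' * (Q 0 ν' * T ν' α')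
          - P m.succ 0 * (Q 0 ν' * Q 0 α' * T ν' α')) := by
        refine Finset.sum_congr rfl fun ν' _ ↦ Finset.sum_congr rfl fun α' _ ↦ ?_
        rw [hδ]
        ring
    _ = ∑ ν' : Fin 4, Q 0 ν' * T ν' m.succ := by
        simp only [Finset.sum_sub_distrib, Matrix.one_apply, ite_mul, one_mul, zero_mul,
          Finset.sum_ite_eq, Finset.mem_univ, if_true, ← Finset.mul_sum, hQQ, mul_zero, sub_zero]

/-! ### Affine changes of variables on `E3` -/

/-- **Linear change of variables** for the Lebesgue integral on `E3`:
`∫ F(A y) dy = |det A|⁻¹ ∫ F(w) dw` for a linear automorphism `A`. [folklore] -/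
theorem integral_comp_linearEquiv_E3 (A : E3 ≃L[ℝ] E3) (F : E3 → ℝ) :
    ∫ y, F (A y) = |LinearMap.det (A.toLinearEquiv : E3 →ₗ[ℝ] E3)|⁻¹ * ∫ w, F w := by
  have hmeas : (⇑A : E3 → E3) = ⇑A.toHomeomorph.toMeasurableEquiv := by
    rw [Homeomorph.toMeasurableEquiv_coe]; rfl
  have hdet : LinearMap.det (A.toLinearEquiv : E3 →ₗ[ℝ] E3) ≠ 0 :=
    (LinearEquiv.isUnit_det' A.toLinearEquiv).ne_zero
  have hmap : Measure.map (⇑A.toHomeomorph.toMeasurableEquiv) (volume : Measure E3) =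
      ENNReal.ofReal |(LinearMap.det (A.toLinearEquiv : E3 →ₗ[ℝ] E3))⁻¹| • (volume : Measure E3) := by
    rw [← hmeas]
    exact map_linearMap_addHaar_eq_smul_addHaar volume hdet
  have hback := integral_map_equiv (μ := (volume : Measure E3)) A.toHomeomorph.toMeasurableEquiv F
  rw [hmeas, ← hback, hmap, integral_smul_measure, ENNReal.toReal_ofReal (abs_nonneg _), abs_inv,
    smul_eq_mul]

/-- **Affine change of variables**: `∫ F(a + A y) dy = |det A|⁻¹ ∫ F(w) dw`. [folklore] -/
theorem integral_comp_affineEquiv_E3 (A : E3 ≃L[ℝ] E3) (a : E3) (F : E3 → ℝ) :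
    ∫ y, F (a + A y) = |LinearMap.det (A.toLinearEquiv : E3 →ₗ[ℝ] E3)|⁻¹ * ∫ w, F w := by
  rw [integral_comp_linearEquiv_E3 A (fun w ↦ F (a + w)), integral_add_left_eq_self]

/-- The determinant of a linear map of `E3` is the determinant of its matrix in the coordinate
basis. [folklore] -/
theorem det_eq_det_matrix_of (A : E3 →ₗ[ℝ] E3) :
    LinearMap.det A = (Matrix.of fun m j : Fin 3 ↦ A (EuclideanSpace.single j (1 : ℝ)) m).det := by
  rw [← LinearMap.det_toMatrix (EuclideanSpace.basisFun (Fin 3) ℝ).toBasis]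
  congr 1

end SublinearIsFree.ChargeModel

/-- Registered sub-goal form (stub `ll_hField_stationary_partialDeriv_zero` of the crux item) of
`SublinearIsFree.ChargeModel.partialDeriv_zero_hField_eq_zero`: stationarity kills `∂₀ h^{μνα}`.
[cite: LandauLifshitz1975, §96 (96.2)] -/
theorem ll_hField_stationary_partialDeriv_zero : open Literature.Geometry.Lorentzian in ∀ (g : E4 → E4 →L[ℝ] E4 →L[ℝ] ℝ), (∀ (x : E4) (s : ℝ), g (x + s • E4.basisVector 0) = g x) → ∀ (x : E4) (μ ν α : Fin 4), DifferentiableAt ℝ (fun z ↦ LandauLifshitz.hField g z μ ν α) x → LandauLifshitz.partialDeriv 0 (fun z ↦ LandauLifshitz.hField g z μ ν α) x = 0 :=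
  fun _g hstat _x _μ _ν _α hd ↦ SublinearIsFree.ChargeModel.partialDeriv_zero_hField_eq_zero hstat hd

end Summit.FinalStateConjecture.FinalStateConjecture.Theorems

end
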